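import Mathlib
import Literature.Analysis.FluidPDE.VorticityCalculus
import Summits.NavierStokesRegularity.NavierStokesRegularity.Theorems.ThreadingFluxHorizonTowerDefs
import HarnessLib

/-!
# Crux `PoloidalLiouville` (stmt-NavierStokesRegularity-1222, W1), crux idea «horizon-threading-tower» (ns-idea-15):
# POINTWISE JET CONVERGENCE CALCULUS — layer (A) of the blow-down programme for `OrderTwoHorizonLawBlowdown`

Support file (`--supports stmt-NavierStokesRegularity-1222`, helper).  Experiment cell `ns-wall-extremal`, width hand
ns-wall-eng-4 g4 (director-ns ruling 02:19:01Z (b): land the layers bottom-up, each a standalone helper).  0 kit.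

THE HYPOTHESIS SHAPE.  `HorizonTower.IsBlowdownLimit` delivers, on the compact `{z}`, convergence of JETS at the point `z`:
`‖iteratedFDeriv ℝ j (fₖ − g) z‖ → 0` for `j ≤ m` (the «difference form»).  This file is the calculus of that hypothesis shape for
sequences `f : ℕ → ℝ³ → F` and limits `g` of class `C^m` (globally — a local limit is made global by a cut-off in the assembly
layer): it is PRESERVED by

* `JetConv.clm_conv` — post-composition with a continuous linear map `L` (same order);
* `JetConv.fderiv_conv` — the derivative `f ↦ fderiv ℝ f` (order `m + 1 ↦ m`), hence `JetConv.curl_conv` (`curl = curlCLM ∘ fderiv`);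
* `JetConv.laplacian_conv` — the Laplacian of vector fields (order `m + 2 ↦ m`; `Δf = Σᵢ D²f[eᵢ, eᵢ]`);
* `JetConv.bilinear_conv` — continuous bilinear maps `B (f, f′)` (same order; Leibniz bound
  `ContinuousLinearMap.norm_iteratedFDeriv_le_of_bilinear`), hence `JetConv.cross_conv`;
* `JetConv.add_conv`, `JetConv.const_smul_conv`, and `JetConv.tendsto_of_conv` (order `0` = plain convergence `fₖ z → g z`).

With these, every polynomial differential expression in a blow-down sequence (`curl`, `Δ`, `×`, sums) converges at `z` to the same
expression in the limit, at the order dictated by the count of derivatives — the bookkeeping behind layers (C)/(D)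
(`λₖ² Loc₂` and the head term of `secondJetHeadForm`).  Pure calculus; nothing here is specific to Navier–Stokes.

HONEST FRAME: toolkit; `PoloidalLiouville` (1222) and NS regularity stay OPEN.
-/

-- the summit and its single problem share the name (D-0017 nested layout)
set_option linter.dupNamespace false

noncomputable section

namespace Summit.NavierStokesRegularity.NavierStokesRegularity.Theorems.PoloidalLiouville.HorizonTower

open Set Function Filter Topology Metric
open scoped Topology RealInnerProductSpace Laplacian ContDiff
open Literature.Analysis.FluidPDE

namespace JetConv

variable {F G W : Type*} [NormedAddCommGroup F] [NormedSpace ℝ F] [NormedAddCommGroup G] [NormedSpace ℝ G]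
  [NormedAddCommGroup W] [NormedSpace ℝ W]

/-- Order zero of the jet convergence is plain convergence of the values. -/
theorem tendsto_of_conv {f : ℕ → E3 → F} {g : E3 → F} {z : E3} {m : ℕ}
    (h : ∀ j ≤ m, Tendsto (fun k => ‖iteratedFDeriv ℝ j (fun y => f k y - g y) z‖) atTop (𝓝 0)) :
    Tendsto (fun k => f k z) atTop (𝓝 (g z)) := by
  rw [tendsto_iff_norm_sub_tendsto_zero]
  simpa only [norm_iteratedFDeriv_zero] using h 0 (Nat.zero_le m)

/-- The jets of the sequence are bounded at every order (by convergence to the jet of the limit). -/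
theorem norm_iteratedFDeriv_le_of_conv {f : ℕ → E3 → F} {g : E3 → F} {z : E3} {m : ℕ}
    (hf : ∀ k, ContDiff ℝ m (f k)) (hg : ContDiff ℝ m g) (k : ℕ) {j : ℕ} (hj : j ≤ m) :
    ‖iteratedFDeriv ℝ j (f k) z‖ ≤ ‖iteratedFDeriv ℝ j (fun y => f k y - g y) z‖ + ‖iteratedFDeriv ℝ j g z‖ := by
  have hfk : ContDiffAt ℝ j (f k) z := ((hf k).of_le (by exact_mod_cast hj)).contDiffAt
  have hgz : ContDiffAt ℝ j g z := (hg.of_le (by exact_mod_cast hj)).contDiffAt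
  have e : f k = (fun y => f k y - g y) + g := by funext y; simp
  have hsub : ContDiffAt ℝ j (fun y => f k y - g y) z := hfk.sub hgz
  calc ‖iteratedFDeriv ℝ j (f k) z‖ = ‖iteratedFDeriv ℝ j ((fun y => f k y - g y) + g) z‖ := by rw [← e]
    _ = ‖iteratedFDeriv ℝ j (fun y => f k y - g y) z + iteratedFDeriv ℝ j g z‖ := by
        rw [iteratedFDeriv_add_apply hsub hgz]
    _ ≤ _ := norm_add_le _ _

/-- **Post-composition with a continuous linear map** preserves jet convergence at every order. -/
theorem clm_conv (L : F →L[ℝ] G) {f : ℕ → E3 → F} {g : E3 → F} {z : E3} {m : ℕ}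
    (hf : ∀ k, ContDiff ℝ m (f k)) (hg : ContDiff ℝ m g)
    (h : ∀ j ≤ m, Tendsto (fun k => ‖iteratedFDeriv ℝ j (fun y => f k y - g y) z‖) atTop (𝓝 0)) :
    ∀ j ≤ m, Tendsto (fun k => ‖iteratedFDeriv ℝ j (fun y => L (f k y) - L (g y)) z‖) atTop (𝓝 0) := by
  intro j hj
  refine squeeze_zero (fun k => norm_nonneg _) (fun k => ?_) (by simpa using (h j hj).const_mul ‖L‖)
  have hsub : ContDiffAt ℝ j (fun y => f k y - g y) z :=
    (((hf k).of_le (by exact_mod_cast hj)).sub (hg.of_le (by exact_mod_cast hj))).contDiffAt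
  have e : (fun y => L (f k y) - L (g y)) = L ∘ fun y => f k y - g y := by funext y; simp
  rw [e, L.iteratedFDeriv_comp_left hsub le_rfl]
  exact L.norm_compContinuousMultilinearMap_le _

/-- **The derivative** lowers the order of jet convergence by one. -/
theorem fderiv_conv {f : ℕ → E3 → F} {g : E3 → F} {z : E3} {m : ℕ}
    (hf : ∀ k, ContDiff ℝ (m + 1) (f k)) (hg : ContDiff ℝ (m + 1) g)
    (h : ∀ j ≤ m + 1, Tendsto (fun k => ‖iteratedFDeriv ℝ j (fun y => f k y - g y) z‖) atTop (𝓝 0)) :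
    ∀ j ≤ m, Tendsto (fun k => ‖iteratedFDeriv ℝ j (fun y => fderiv ℝ (f k) y - fderiv ℝ g y) z‖) atTop (𝓝 0) := by
  intro j hj
  refine (h (j + 1) (by omega)).congr fun k => ?_
  have hfd : ∀ y, DifferentiableAt ℝ (f k) y := fun y => (hf k).differentiable (by simp) y
  have hgd : ∀ y, DifferentiableAt ℝ g y := fun y => hg.differentiable (by simp) y
  have e : (fun y => fderiv ℝ (f k) y - fderiv ℝ g y) = _root_.fderiv ℝ (fun y => f k y - g y) := by
    funext y; rw [fderiv_fun_sub (hfd y) (hgd y)]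
  rw [e, norm_iteratedFDeriv_fderiv]

/-- **The curl** lowers the order by one (`curl = curlCLM ∘ fderiv`). -/
theorem curl_conv {f : ℕ → E3 → E3} {g : E3 → E3} {z : E3} {m : ℕ}
    (hf : ∀ k, ContDiff ℝ (m + 1) (f k)) (hg : ContDiff ℝ (m + 1) g)
    (h : ∀ j ≤ m + 1, Tendsto (fun k => ‖iteratedFDeriv ℝ j (fun y => f k y - g y) z‖) atTop (𝓝 0)) :
    ∀ j ≤ m, Tendsto (fun k => ‖iteratedFDeriv ℝ j (fun y => curl (f k) y - curl g y) z‖) atTop (𝓝 0) := by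
  have hdf : ∀ k, ContDiff ℝ m (_root_.fderiv ℝ (f k)) := fun k => (hf k).fderiv_right le_rfl
  have hdg : ContDiff ℝ m (_root_.fderiv ℝ g) := hg.fderiv_right le_rfl
  have h1 := clm_conv curlCLM hdf hdg (fderiv_conv hf hg h)
  simpa only [curl_eq_curlCLM] using h1

/-- **Sums** preserve jet convergence. -/
theorem add_conv {f f' : ℕ → E3 → F} {g g' : E3 → F} {z : E3} {m : ℕ}
    (hf : ∀ k, ContDiff ℝ m (f k)) (hg : ContDiff ℝ m g) (hf' : ∀ k, ContDiff ℝ m (f' k)) (hg' : ContDiff ℝ m g')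
    (h : ∀ j ≤ m, Tendsto (fun k => ‖iteratedFDeriv ℝ j (fun y => f k y - g y) z‖) atTop (𝓝 0))
    (h' : ∀ j ≤ m, Tendsto (fun k => ‖iteratedFDeriv ℝ j (fun y => f' k y - g' y) z‖) atTop (𝓝 0)) :
    ∀ j ≤ m, Tendsto (fun k => ‖iteratedFDeriv ℝ j (fun y => (f k y + f' k y) - (g y + g' y)) z‖) atTop (𝓝 0) := by
  intro j hj
  have hlim := (h j hj).add (h' j hj)
  rw [add_zero] at hlim
  refine squeeze_zero (fun k => norm_nonneg _) (fun k => ?_) hlim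
  have h1 : ContDiffAt ℝ j (fun y => f k y - g y) z :=
    (((hf k).of_le (by exact_mod_cast hj)).sub (hg.of_le (by exact_mod_cast hj))).contDiffAt
  have h2 : ContDiffAt ℝ j (fun y => f' k y - g' y) z :=
    (((hf' k).of_le (by exact_mod_cast hj)).sub (hg'.of_le (by exact_mod_cast hj))).contDiffAt
  have e : (fun y => (f k y + f' k y) - (g y + g' y)) = (fun y => f k y - g y) + fun y => f' k y - g' y := by
    funext y; simp only [Pi.add_apply]; abel
  rw [e, iteratedFDeriv_add_apply h1 h2]
  exact norm_add_le _ _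

/-- **Constant scalar multiples** preserve jet convergence. -/
theorem const_smul_conv (c : ℝ) {f : ℕ → E3 → F} {g : E3 → F} {z : E3} {m : ℕ}
    (hf : ∀ k, ContDiff ℝ m (f k)) (hg : ContDiff ℝ m g)
    (h : ∀ j ≤ m, Tendsto (fun k => ‖iteratedFDeriv ℝ j (fun y => f k y - g y) z‖) atTop (𝓝 0)) :
    ∀ j ≤ m, Tendsto (fun k => ‖iteratedFDeriv ℝ j (fun y => c • f k y - c • g y) z‖) atTop (𝓝 0) := by
  have h1 := clm_conv (c • ContinuousLinearMap.id ℝ F) hf hg h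
  simpa only [smul_apply, ContinuousLinearMap.id_apply] using h1

/-- **Continuous bilinear maps** preserve jet convergence (Leibniz bound for iterated derivatives). -/
theorem bilinear_conv (B : F →L[ℝ] G →L[ℝ] W) {f : ℕ → E3 → F} {g : E3 → F} {f' : ℕ → E3 → G} {g' : E3 → G}
    {z : E3} {m : ℕ} (hf : ∀ k, ContDiff ℝ m (f k)) (hg : ContDiff ℝ m g) (hf' : ∀ k, ContDiff ℝ m (f' k))
    (hg' : ContDiff ℝ m g')
    (h : ∀ j ≤ m, Tendsto (fun k => ‖iteratedFDeriv ℝ j (fun y => f k y - g y) z‖) atTop (𝓝 0))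
    (h' : ∀ j ≤ m, Tendsto (fun k => ‖iteratedFDeriv ℝ j (fun y => f' k y - g' y) z‖) atTop (𝓝 0)) :
    ∀ j ≤ m, Tendsto (fun k => ‖iteratedFDeriv ℝ j (fun y => B (f k y) (f' k y) - B (g y) (g' y)) z‖) atTop (𝓝 0) := by
  intro j hj
  have hjm : (j : WithTop ℕ∞) ≤ (m : WithTop ℕ∞) := by exact_mod_cast hj
  -- the two Leibniz bounds
  set a : ℕ → ℕ → ℝ := fun i k => ‖iteratedFDeriv ℝ i (fun y => f k y - g y) z‖ with ha
  set a' : ℕ → ℕ → ℝ := fun i k => ‖iteratedFDeriv ℝ i (fun y => f' k y - g' y) z‖ with ha'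
  set cg : ℕ → ℝ := fun i => ‖iteratedFDeriv ℝ i g z‖ with hcg
  set cg' : ℕ → ℝ := fun i => ‖iteratedFDeriv ℝ i g' z‖ with hcg'
  have hdiff : ∀ k, ContDiff ℝ m (fun y => f k y - g y) := fun k => (hf k).sub hg
  have hdiff' : ∀ k, ContDiff ℝ m (fun y => f' k y - g' y) := fun k => (hf' k).sub hg'
  -- bound: ‖D^j (B(fₖ,f'ₖ) − B(g,g'))‖ ≤ ‖B‖ Σ C(j,i) aᵢ (a'_{j−i} + cg'_{j−i}) + ‖B‖ Σ C(j,i) cgᵢ a'_{j−i}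
  set bound : ℕ → ℝ := fun k =>
    ‖B‖ * ∑ i ∈ Finset.range (j + 1), (j.choose i : ℝ) * a i k * (a' (j - i) k + cg' (j - i))
      + ‖B‖ * ∑ i ∈ Finset.range (j + 1), (j.choose i : ℝ) * cg i * a' (j - i) k with hbound
  have hbound_tendsto : Tendsto bound atTop (𝓝 0) := by
    have h0 : Tendsto (fun k => ‖B‖ * ∑ i ∈ Finset.range (j + 1), (j.choose i : ℝ) * a i k * (a' (j - i) k + cg' (j - i)))
        atTop (𝓝 (‖B‖ * ∑ i ∈ Finset.range (j + 1), (j.choose i : ℝ) * 0 * (0 + cg' (j - i)))) := by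
      refine (tendsto_finsetSum _ fun i hi => ?_).const_mul ‖B‖
      have hij : i ≤ m := by have := Finset.mem_range.mp hi; omega
      have hji : j - i ≤ m := by omega
      exact ((h i hij).const_mul _).mul ((h' (j - i) hji).add tendsto_const_nhds)
    have h1 : Tendsto (fun k => ‖B‖ * ∑ i ∈ Finset.range (j + 1), (j.choose i : ℝ) * cg i * a' (j - i) k)
        atTop (𝓝 (‖B‖ * ∑ i ∈ Finset.range (j + 1), (j.choose i : ℝ) * cg i * 0)) := by
      refine (tendsto_finsetSum _ fun i hi => ?_).const_mul ‖B‖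
      have hji : j - i ≤ m := by omega
      exact (h' (j - i) hji).const_mul _
    have hsum := h0.add h1
    simpa using hsum
  refine squeeze_zero (fun k => norm_nonneg _) (fun k => ?_) hbound_tendsto
  -- split `B(fₖ, f'ₖ) − B(g, g') = B(fₖ − g, f'ₖ) + B(g, f'ₖ − g')`
  have e : (fun y => B (f k y) (f' k y) - B (g y) (g' y))
      = (fun y => B (f k y - g y) (f' k y)) + fun y => B (g y) (f' k y - g' y) := by
    funext y; simp only [Pi.add_apply, map_sub, sub_apply]; abel
  have hB1 : ContDiff ℝ m (fun y => B (f k y - g y) (f' k y)) := B.isBoundedBilinearMap.contDiff.comp ((hdiff k).prodMk (hf' k))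
  have hB2 : ContDiff ℝ m (fun y => B (g y) (f' k y - g' y)) := B.isBoundedBilinearMap.contDiff.comp (hg.prodMk (hdiff' k))
  rw [e, iteratedFDeriv_add_apply (hB1.of_le hjm).contDiffAt (hB2.of_le hjm).contDiffAt]
  refine (norm_add_le _ _).trans (add_le_add ?_ ?_)
  · refine (B.norm_iteratedFDeriv_le_of_bilinear (hdiff k) (hf' k) z hjm).trans ?_
    refine mul_le_mul_of_nonneg_left (Finset.sum_le_sum fun i hi => ?_) (norm_nonneg B)
    have hji : j - i ≤ m := by omega
    refine mul_le_mul_of_nonneg_left (norm_iteratedFDeriv_le_of_conv hf' hg' k hji) ?_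
    exact mul_nonneg (Nat.cast_nonneg _) (norm_nonneg _)
  · refine (B.norm_iteratedFDeriv_le_of_bilinear hg (hdiff' k) z hjm).trans (le_of_eq ?_)
    rfl

/-- **The cross product** preserves jet convergence. -/
theorem cross_conv {f f' : ℕ → E3 → E3} {g g' : E3 → E3} {z : E3} {m : ℕ}
    (hf : ∀ k, ContDiff ℝ m (f k)) (hg : ContDiff ℝ m g) (hf' : ∀ k, ContDiff ℝ m (f' k)) (hg' : ContDiff ℝ m g')
    (h : ∀ j ≤ m, Tendsto (fun k => ‖iteratedFDeriv ℝ j (fun y => f k y - g y) z‖) atTop (𝓝 0))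
    (h' : ∀ j ≤ m, Tendsto (fun k => ‖iteratedFDeriv ℝ j (fun y => f' k y - g' y) z‖) atTop (𝓝 0)) :
    ∀ j ≤ m, Tendsto (fun k => ‖iteratedFDeriv ℝ j
      (fun y => cross (f k y) (f' k y) - cross (g y) (g' y)) z‖) atTop (𝓝 0) := by
  simpa only [crossCLM_apply] using bilinear_conv crossCLM hf hg hf' hg' h h'

/-- **The Laplacian of a vector field** lowers the order by two (`Δf(y) = Σᵢ D²f(y)[eᵢ, eᵢ]`). -/
theorem laplacian_conv {f : ℕ → E3 → F} {g : E3 → F} {z : E3} {m : ℕ}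
    (hf : ∀ k, ContDiff ℝ (m + 2) (f k)) (hg : ContDiff ℝ (m + 2) g)
    (h : ∀ j ≤ m + 2, Tendsto (fun k => ‖iteratedFDeriv ℝ j (fun y => f k y - g y) z‖) atTop (𝓝 0)) :
    ∀ j ≤ m, Tendsto (fun k => ‖iteratedFDeriv ℝ j (fun y => (Δ (f k)) y - (Δ g) y) z‖) atTop (𝓝 0) := by
  -- `Δφ = T (D(Dφ))` with `T L = Σᵢ L eᵢ eᵢ`
  set e : OrthonormalBasis (Fin 3) ℝ E3 := EuclideanSpace.basisFun (Fin 3) ℝ with he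
  set T : (E3 →L[ℝ] E3 →L[ℝ] F) →L[ℝ] F :=
    ∑ i, (ContinuousLinearMap.apply ℝ F (e i)).comp (ContinuousLinearMap.apply ℝ (E3 →L[ℝ] F) (e i)) with hT
  have hΔ : ∀ (φ : E3 → F), Δ φ = fun y => T (_root_.fderiv ℝ (_root_.fderiv ℝ φ) y) := by
    intro φ
    rw [InnerProductSpace.laplacian_eq_iteratedFDeriv_orthonormalBasis φ e]
    funext y
    simp only [hT, sum_apply, ContinuousLinearMap.comp_apply, ContinuousLinearMap.apply_apply]
    exact Finset.sum_congr rfl fun i _ => by rw [iteratedFDeriv_two_apply]; rfl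
  have hf1 : ∀ k, ContDiff ℝ (m + 1) (_root_.fderiv ℝ (f k)) := fun k => (hf k).fderiv_right (by norm_cast)
  have hg1 : ContDiff ℝ (m + 1) (_root_.fderiv ℝ g) := hg.fderiv_right (by norm_cast)
  have hf2 : ∀ k, ContDiff ℝ m (_root_.fderiv ℝ (_root_.fderiv ℝ (f k))) := fun k => (hf1 k).fderiv_right le_rfl
  have hg2 : ContDiff ℝ m (_root_.fderiv ℝ (_root_.fderiv ℝ g)) := hg1.fderiv_right le_rfl
  have h2 := fderiv_conv hf1 hg1 (fderiv_conv hf hg h)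
  have h3 := clm_conv T hf2 hg2 h2
  intro j hj
  have := h3 j hj
  simpa only [hΔ] using this

/-- **Entry point**: a blow-down limit in the sense of `IsBlowdownLimit` gives, at every `z ≠ 0`, jet convergence in the
difference form at all orders `j ≤ 6` for the velocity and `j ≤ 2` for the pressure (test the hypothesis on the compact `{z}`). -/
theorem of_isBlowdownLimit {w : E3 → E3} {q : E3 → ℝ} {x₀ : E3} {U : E3 → E3} {P : E3 → ℝ}
    (h : IsBlowdownLimit w q x₀ U P) :
    ∃ (lam : ℕ → ℝ) (c : ℕ → ℝ), Tendsto lam atTop atTop ∧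
      (∀ z : E3, z ≠ 0 → ∀ j ≤ 6,
        Tendsto (fun k => ‖iteratedFDeriv ℝ j (fun y : E3 => w (x₀ + lam k • y) - U y) z‖) atTop (𝓝 0)) ∧
      (∀ z : E3, z ≠ 0 → ∀ j ≤ 2,
        Tendsto (fun k => ‖iteratedFDeriv ℝ j (fun y : E3 => q (x₀ + lam k • y) - c k - P y) z‖) atTop (𝓝 0)) := by
  obtain ⟨lam, c, hlam, hV, hP⟩ := h
  have h0 : ∀ z : E3, z ≠ 0 → (0 : E3) ∉ ({z} : Set E3) := fun z hz => by
    rw [Set.mem_singleton_iff]; exact fun h => hz h.symm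
  refine ⟨lam, c, hlam, fun z hz j hj => ?_, fun z hz j hj => ?_⟩
  · simpa only [Set.image_singleton, csSup_singleton] using hV {z} isCompact_singleton (h0 z hz) j hj
  · simpa only [Set.image_singleton, csSup_singleton] using hP {z} isCompact_singleton (h0 z hz) j hj

end JetConv

end Summit.NavierStokesRegularity.NavierStokesRegularity.Theorems.PoloidalLiouville.HorizonTower

end
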